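import Mathlib.Analysis.Convex.SpecificFunctions.Basic
import Mathlib.Analysis.Convex.Jensen
import Literature.Probability.LatticeModels.RandomClusterFKG
import HarnessLib

/-!
# Finite-volume pressure of the random-cluster model: the tangent inequality, the cost of a
# boundary condition, and equality of FKG-ordered measures with equal edge densities

Topic `Literature/Probability/LatticeModels`. Three elementary finite-graph facts about the
random-cluster measure `φ^B_{G,p,q}` (`RandomCluster.lean`) that drive Grimmett's proof of the
a.e.-uniqueness theorem (Grimmett 2006, Thm. (4.63): `h⁰(p,q) = h¹(p,q)`, hence `φ⁰_{p,q} = φ¹_{p,q}`,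
for all but countably many `p`), in a form that avoids the thermodynamic limit of the pressure:

* `rcExpect`, `rcMeasure_real_eq_rcExpect`, `rcExpect_card_eq_sum_real_edgeOpen` — expectations as
  finite sums; `E|ω| = ∑_e φ(J_e)` (Grimmett 2006, (4.72)–(4.73): the `π`-derivative of the
  finite-volume pressure is the mean number of open edges).
* `log_rcPartitionFunction_sub_ge` — the **tangent inequality** of the finite-volume pressure, by
  Jensen's inequality: for `p₁, p₂ ∈ (0,1)`,
  `log Z(p₂) - log Z(p₁) ≥ log(p₂/p₁) E_{p₁}|ω| + log((1-p₂)/(1-p₁)) (|E| - E_{p₁}|ω|)`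
  (convexity of `log Y_Λ` in `π = log(p/(1-p))`, Grimmett 2006, proof of Thm. (4.58) and Thm. (3.73)).
* `clusterCount_empty_le_add_card`, `rcPartitionFunction_wired_le_free`,
  `rcPartitionFunction_free_le_pow_mul_wired` — wiring a finite set `B` lowers the number of
  clusters by at most `|B| - 1`, so `Z^B ≤ Z^∅ ≤ q^{|B|-1} Z^B` for `q ≥ 1` (Grimmett 2006, proof of
  Thm. (4.58): `Y⁰_Λ e^{-κ|∂Λ|} ≤ Y^ξ_Λ ≤ Y⁰_Λ`).
* `mul_sub_sum_edgeOpen_le` — the consequence used for a.e. uniqueness: for `0 < p < p' < 1`, `q ≥ 1`,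
  `[log(p'/p) + log((1-p)/(1-p'))] (∑_e φ^B_p(J_e) - ∑_e φ^∅_{p'}(J_e)) ≤ (|B| - 1) log q`
  (Grimmett 2006, proof of Thm. (4.63), (4.73)–(4.75)).
* `real_sub_real_le_sum_edgeOpen_sub` — Grimmett 2006, Prop. (4.6) in finite volume and in
  quantitative form: if `φ₁ ≤ φ₂` on increasing events then for every increasing event `A`
  determined by the edges of `F`, `φ₂(A) - φ₁(A) ≤ ∑_{e ∈ F} (φ₂(J_e) - φ₁(J_e))`; proved without
  coupling, from the observation that `ω ↦ |ω ∩ F| - 1_A(ω)` is increasing.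

Everything is proved; no named facts.

## References

* G. Grimmett, *The Random-Cluster Model*, Springer 2006: Prop. (4.6); Thm. (3.73); Thm. (4.58)
  and its proof (boundary-condition bounds, convexity of `G^ξ_Λ`); Thm. (4.63) and its proof,
  (4.72)–(4.75). [Grimmett2006]
-/

noncomputable section

open MeasureTheory Finset SimpleGraph

namespace Literature.Probability.LatticeModels

variable {V : Type*} [Fintype V] [DecidableEq V] (G : SimpleGraph V) [DecidableRel G.Adj]

/-! ### Expectations under the random-cluster measure as finite sums -/

section Expect

/-- The expectation of a function of the (finite) configuration under `φ^B_{G,p,q}`, written as the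
finite sum `∑_{ω ⊆ E} (w(ω)/Z) g(ω)`. [cite: Grimmett2006, §1.2, eq. (1.2)] -/
def rcExpect (p q : ℝ) (B : Set V) (g : Finset (Sym2 V) → ℝ) : ℝ :=
  ∑ ω ∈ G.edgeFinset.powerset, rcWeight G p q B ω / rcPartitionFunction G p q B * g ω

/-- The event "the edge `e` is open", `J_e`. [cite: Grimmett2006, Prop. (4.6) (J_e)] -/
def edgeOpen (e : Sym2 V) : Set (Percolation.BondConfig V) := {ω | e ∈ ω}

omit [Fintype V] [DecidableEq V] in
/-- Membership in `J_e`. [cite: Grimmett2006, Prop. (4.6)] -/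
@[simp] theorem mem_edgeOpen_iff (e : Sym2 V) (ω : Percolation.BondConfig V) :
    ω ∈ edgeOpen e ↔ e ∈ ω := Iff.rfl

omit [Fintype V] [DecidableEq V] in
/-- `J_e` is an increasing event. [cite: Grimmett2006, Prop. (4.6)] -/
theorem isUpperSet_edgeOpen (e : Sym2 V) : IsUpperSet (edgeOpen e) :=
  fun _ _ h he => h he

/-- The probability of an event is the expectation of its indicator.
[cite: Grimmett2006, §1.2, eq. (1.2)] -/
theorem rcMeasure_real_eq_rcExpect {p q : ℝ} (hp : p ∈ Set.Icc (0 : ℝ) 1) (hq : 0 < q) (B : Set V)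
    (A : Set (Percolation.BondConfig V)) [DecidablePred (· ∈ A)] :
    (rcMeasure G p q B).real A =
      rcExpect G p q B (fun ω => if (↑ω : Percolation.BondConfig V) ∈ A then 1 else 0) := by
  rw [rcMeasure_real_apply G hp hq B A, rcExpect]
  refine Finset.sum_congr rfl fun ω _ => ?_
  split_ifs <;> simp

/-- The weights `w(ω)/Z` sum to one. [cite: Grimmett2006, §1.2, eq. (1.3)] -/
theorem rcExpect_one {p q : ℝ} (hp : p ∈ Set.Icc (0 : ℝ) 1) (hq : 0 < q) (B : Set V) :
    rcExpect G p q B (fun _ => 1) = 1 := by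
  have hZ := rcPartitionFunction_pos G hp hq B
  simp only [rcExpect, mul_one]
  rw [← Finset.sum_div, ← rcPartitionFunction, div_self hZ.ne']

/-- Linearity: sums. [folklore] -/
theorem rcExpect_add (p q : ℝ) (B : Set V) (g h : Finset (Sym2 V) → ℝ) :
    rcExpect G p q B (fun ω => g ω + h ω) = rcExpect G p q B g + rcExpect G p q B h := by
  simp only [rcExpect, mul_add, Finset.sum_add_distrib]

/-- Linearity: differences. [folklore] -/
theorem rcExpect_sub (p q : ℝ) (B : Set V) (g h : Finset (Sym2 V) → ℝ) :
    rcExpect G p q B (fun ω => g ω - h ω) = rcExpect G p q B g - rcExpect G p q B h := by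
  simp only [rcExpect, mul_sub, Finset.sum_sub_distrib]

/-- Linearity: scalars. [folklore] -/
theorem rcExpect_const_mul (p q : ℝ) (B : Set V) (c : ℝ) (g : Finset (Sym2 V) → ℝ) :
    rcExpect G p q B (fun ω => c * g ω) = c * rcExpect G p q B g := by
  simp only [rcExpect, Finset.mul_sum]
  exact Finset.sum_congr rfl fun ω _ => by ring

/-- Linearity: finite sums. [folklore] -/
theorem rcExpect_finset_sum {ι : Type*} (s : Finset ι) (p q : ℝ) (B : Set V)
    (g : ι → Finset (Sym2 V) → ℝ) :
    rcExpect G p q B (fun ω => ∑ i ∈ s, g i ω) = ∑ i ∈ s, rcExpect G p q B (g i) := by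
  simp only [rcExpect, Finset.mul_sum]
  rw [Finset.sum_comm]

/-- Expectations of functions that agree on the edge sets of `G` agree. [folklore] -/
theorem rcExpect_congr (p q : ℝ) (B : Set V) {g h : Finset (Sym2 V) → ℝ}
    (hgh : ∀ ω ⊆ G.edgeFinset, g ω = h ω) : rcExpect G p q B g = rcExpect G p q B h :=
  Finset.sum_congr rfl fun ω hω => by rw [hgh ω (Finset.mem_powerset.1 hω)]

/-- The expectation of a constant. [folklore] -/
theorem rcExpect_const {p q : ℝ} (hp : p ∈ Set.Icc (0 : ℝ) 1) (hq : 0 < q) (B : Set V) (c : ℝ) :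
    rcExpect G p q B (fun _ => c) = c := by
  have h1 := rcExpect_one G hp hq B
  simp only [rcExpect, mul_one] at h1
  simp only [rcExpect]
  rw [← Finset.sum_mul, h1, one_mul]

/-- Monotonicity: `g ≤ h` on edge sets of `G` implies `E g ≤ E h`. [folklore] -/
theorem rcExpect_mono {p q : ℝ} (hp : p ∈ Set.Icc (0 : ℝ) 1) (hq : 0 < q) (B : Set V)
    {g h : Finset (Sym2 V) → ℝ} (hgh : ∀ ω ⊆ G.edgeFinset, g ω ≤ h ω) :
    rcExpect G p q B g ≤ rcExpect G p q B h := by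
  have hZ := rcPartitionFunction_pos G hp hq B
  refine Finset.sum_le_sum fun ω hω => ?_
  exact mul_le_mul_of_nonneg_left (hgh ω (Finset.mem_powerset.1 hω))
    (div_nonneg (rcWeight_nonneg G hp hq.le B ω) hZ.le)

/-- **The mean number of open edges is the sum of the edge densities**:
`E^B_{G,p,q}|ω| = ∑_{e ∈ E(G)} φ^B_{G,p,q}(J_e)` (Grimmett 2006, (4.72)–(4.75)).
[cite: Grimmett2006, proof of Thm. (4.63), (4.73)–(4.75)] -/
theorem rcExpect_card_eq_sum_real_edgeOpen {p q : ℝ} (hp : p ∈ Set.Icc (0 : ℝ) 1) (hq : 0 < q)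
    (B : Set V) :
    rcExpect G p q B (fun ω => (#ω : ℝ)) =
      ∑ e ∈ G.edgeFinset, (rcMeasure G p q B).real (edgeOpen e) := by
  classical
  have hrw : ∀ e ∈ G.edgeFinset, (rcMeasure G p q B).real (edgeOpen e) =
      rcExpect G p q B (fun ω => if e ∈ ω then 1 else 0) := by
    intro e _
    rw [rcMeasure_real_eq_rcExpect G hp hq B]
    refine rcExpect_congr G p q B fun ω _ => ?_
    simp only [mem_edgeOpen_iff, Finset.mem_coe]
  rw [Finset.sum_congr rfl hrw, ← rcExpect_finset_sum]
  refine rcExpect_congr G p q B fun ω hω => ?_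
  rw [Finset.sum_boole, Finset.filter_mem_eq_inter, Finset.inter_eq_right.2 hω]

end Expect

/-! ### The tangent inequality of the finite-volume pressure (Jensen) -/

section Jensen

/-- Changing `p`: `w_{p₂}(ω) = w_{p₁}(ω) · (p₂/p₁)^{|ω|} ((1-p₂)/(1-p₁))^{|E∖ω|}` for `p₁ ∈ (0,1)`.
[cite: Grimmett2006, §1.2, eq. (1.2)] -/
theorem rcWeight_eq_mul_ratio {p₁ : ℝ} (hp₁ : p₁ ∈ Set.Ioo (0 : ℝ) 1) (p₂ q : ℝ) (B : Set V)
    (ω : Finset (Sym2 V)) :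
    rcWeight G p₂ q B ω = rcWeight G p₁ q B ω *
      ((p₂ / p₁) ^ #ω * ((1 - p₂) / (1 - p₁)) ^ #(G.edgeFinset \ ω)) := by
  have h1 : p₁ ≠ 0 := hp₁.1.ne'
  have h2 : 1 - p₁ ≠ 0 := (sub_pos.2 hp₁.2).ne'
  unfold rcWeight
  rw [div_pow, div_pow]
  field_simp

/-- **Tangent inequality of the finite-volume pressure** (Jensen's inequality for `log`; the
convexity of `π ↦ log Y^B_G(π, κ)` of Grimmett 2006, proof of Thm. (4.58), with the derivative
formula (4.72)–(4.73)): for `p₁, p₂ ∈ (0, 1)` and `q > 0`,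
`log Z(p₂) - log Z(p₁) ≥ log(p₂/p₁) E_{p₁}|ω| + log((1-p₂)/(1-p₁)) (|E| - E_{p₁}|ω|)`.
[cite: Grimmett2006, proof of Thm. (4.58) (convexity of G^ξ_Λ) and (4.72)–(4.73)] -/
theorem log_rcPartitionFunction_sub_ge {p₁ p₂ q : ℝ} (hp₁ : p₁ ∈ Set.Ioo (0 : ℝ) 1)
    (hp₂ : p₂ ∈ Set.Ioo (0 : ℝ) 1) (hq : 0 < q) (B : Set V) :
    Real.log (p₂ / p₁) * rcExpect G p₁ q B (fun ω => (#ω : ℝ)) +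
        Real.log ((1 - p₂) / (1 - p₁)) * ((#G.edgeFinset : ℝ) - rcExpect G p₁ q B (fun ω => (#ω : ℝ))) ≤
      Real.log (rcPartitionFunction G p₂ q B) - Real.log (rcPartitionFunction G p₁ q B) := by
  have hp₁' : p₁ ∈ Set.Icc (0 : ℝ) 1 := ⟨hp₁.1.le, hp₁.2.le⟩
  have hZ₁ := rcPartitionFunction_pos G hp₁' hq B
  have hZ₂ := rcPartitionFunction_pos G ⟨hp₂.1.le, hp₂.2.le⟩ hq B
  have ha : 0 < p₂ / p₁ := div_pos hp₂.1 hp₁.1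
  have hb : 0 < (1 - p₂) / (1 - p₁) := div_pos (sub_pos.2 hp₂.2) (sub_pos.2 hp₁.2)
  set R : Finset (Sym2 V) → ℝ := fun ω =>
    (p₂ / p₁) ^ #ω * ((1 - p₂) / (1 - p₁)) ^ #(G.edgeFinset \ ω) with hR
  have hRpos : ∀ ω, 0 < R ω := fun ω => mul_pos (pow_pos ha _) (pow_pos hb _)
  -- `Z(p₂)/Z(p₁) = E_{p₁} R`
  have hquot : rcPartitionFunction G p₂ q B / rcPartitionFunction G p₁ q B = rcExpect G p₁ q B R := by
    rw [rcExpect, rcPartitionFunction, Finset.sum_div]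
    refine Finset.sum_congr rfl fun ω _ => ?_
    rw [rcWeight_eq_mul_ratio G hp₁ p₂ q B ω, mul_div_right_comm]
  -- Jensen for the concave function `log`
  have hJ : rcExpect G p₁ q B (fun ω => Real.log (R ω)) ≤ Real.log (rcExpect G p₁ q B R) := by
    have := (strictConcaveOn_log_Ioi.concaveOn).le_map_sum
      (t := G.edgeFinset.powerset)
      (w := fun ω => rcWeight G p₁ q B ω / rcPartitionFunction G p₁ q B) (p := R)
      (fun ω _ => div_nonneg (rcWeight_nonneg G hp₁' hq.le B ω) hZ₁.le)
      (by
        have h := rcExpect_one G hp₁' hq B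
        simpa [rcExpect] using h)
      (fun ω _ => hRpos ω)
    simpa [rcExpect, smul_eq_mul] using this
  -- the left side is `E log R`
  have hlogR : ∀ ω ⊆ G.edgeFinset, Real.log (R ω) =
      Real.log (p₂ / p₁) * (#ω : ℝ) + Real.log ((1 - p₂) / (1 - p₁)) * ((#G.edgeFinset : ℝ) - (#ω : ℝ)) := by
    intro ω hω
    rw [hR]
    dsimp only
    rw [Real.log_mul (pow_pos ha _).ne' (pow_pos hb _).ne', Real.log_pow, Real.log_pow,
      Finset.card_sdiff_of_subset hω, Nat.cast_sub (Finset.card_le_card hω)]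
    ring
  have hE : rcExpect G p₁ q B (fun ω => Real.log (R ω)) =
      Real.log (p₂ / p₁) * rcExpect G p₁ q B (fun ω => (#ω : ℝ)) +
        Real.log ((1 - p₂) / (1 - p₁)) * ((#G.edgeFinset : ℝ) - rcExpect G p₁ q B (fun ω => (#ω : ℝ))) := by
    rw [rcExpect_congr G p₁ q B hlogR, rcExpect_add, rcExpect_const_mul, rcExpect_const_mul,
      rcExpect_sub, rcExpect_const G hp₁' hq]
  rw [← hE, ← Real.log_div hZ₂.ne' hZ₁.ne', hquot]
  exact hJ

end Jensen

/-! ### The cost of a boundary condition: wiring `B` changes `log Z` by at most `(|B|-1) log q` -/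

section Wiring

omit [Fintype V] [DecidableEq V] in
/-- Two graphs `G₁ ≤ G₂` such that every edge of `G₂` joins `G₁`-connected vertices have the same
reachability relation. [folklore] -/
theorem reachable_of_le_of_adj_reachable {G₁ G₂ : SimpleGraph V}
    (hadj : ∀ x y, G₂.Adj x y → G₁.Reachable x y) {x y : V} (hxy : G₂.Reachable x y) :
    G₁.Reachable x y := by
  obtain ⟨w⟩ := hxy
  induction w with
  | nil => exact Reachable.refl _
  | cons h _ ih => exact (hadj _ _ h).trans ih

omit [Fintype V] [DecidableEq V] in
/-- Two graphs `G₁ ≤ G₂` with the same reachability relation have equally many connected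
components. [folklore] -/
theorem card_connectedComponent_eq_of_le_of_adj_reachable [Finite V] {G₁ G₂ : SimpleGraph V}
    (hle : G₁ ≤ G₂) (hadj : ∀ x y, G₂.Adj x y → G₁.Reachable x y) :
    Nat.card G₁.ConnectedComponent = Nat.card G₂.ConnectedComponent := by
  refine Nat.card_eq_of_bijective (ConnectedComponent.map (Hom.ofLE hle))
    ⟨?_, ConnectedComponent.surjective_map_ofLE hle⟩
  intro c₁ c₂ h
  induction c₁ using ConnectedComponent.ind with
  | h x =>
    induction c₂ using ConnectedComponent.ind with
    | h y =>
      rw [ConnectedComponent.map_mk, ConnectedComponent.map_mk] at h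
      exact ConnectedComponent.sound
        (reachable_of_le_of_adj_reachable hadj (ConnectedComponent.exact h))

omit [Fintype V] [DecidableEq V] in
/-- Wiring a singleton does nothing. [cite: Grimmett2006, §4.2 (wired boundary conditions)] -/
theorem wired_singleton (b : V) : wired ({b} : Set V) = ⊥ := by
  ext x y
  simp only [wired_adj, Set.mem_singleton_iff, bot_adj, iff_false, not_and]
  rintro hxy rfl rfl
  exact hxy rfl

omit [Fintype V] [DecidableEq V] in
/-- The free cluster count is the cluster count with a singleton wired.
[cite: Grimmett2006, §4.2 (wired boundary conditions)] -/
theorem clusterCount_singleton (ω : Percolation.BondConfig V) (b : V) :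
    clusterCount ω ({b} : Set V) = clusterCount ω ∅ := by
  rw [clusterCount, clusterCount, wired_singleton, wired_empty]

omit [Fintype V] in
/-- **Wiring one more vertex lowers the number of clusters by at most one**: for `b₀ ∈ T`,
`k^T(ω) ≤ k^{T ∪ {b}}(ω) + 1` (the wired graph of `T ∪ {b}` has the same components as the wired
graph of `T` plus the single edge `b b₀`). [cite: Grimmett2006, proof of Thm. (4.58) (k(ω⁰_Λ) − |∂Λ| ≤ k(ω¹_Λ))] -/
theorem clusterCount_le_clusterCount_insert_add_one [Finite V] (ω : Percolation.BondConfig V)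
    {T : Set V} {b₀ : V} (hb₀ : b₀ ∈ T) (b : V) :
    clusterCount ω T ≤ clusterCount ω (insert b T) + 1 := by
  classical
  by_cases hb : b = b₀
  · subst hb
    rw [Set.insert_eq_of_mem hb₀]
    exact Nat.le_succ _
  · unfold clusterCount
    set H := Percolation.openGraph ω ⊔ wired T with hH
    have hle : H ⊔ edge b b₀ ≤ Percolation.openGraph ω ⊔ wired (insert b T) := by
      refine sup_le (sup_le_sup_left (fun x y hxy => ?_) _) ?_
      · rw [wired_adj] at hxy ⊢
        exact ⟨hxy.1, Set.mem_insert_of_mem _ hxy.2.1, Set.mem_insert_of_mem _ hxy.2.2⟩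
      · intro x y hxy
        rw [edge_adj] at hxy
        refine Or.inr ((wired_adj _ _ _).2 ⟨hxy.2, ?_, ?_⟩)
        · rcases hxy.1 with ⟨rfl, -⟩ | ⟨rfl, -⟩
          · exact Set.mem_insert _ _
          · exact Set.mem_insert_of_mem _ hb₀
        · rcases hxy.1 with ⟨-, rfl⟩ | ⟨-, rfl⟩
          · exact Set.mem_insert_of_mem _ hb₀
          · exact Set.mem_insert _ _
    have hadj : ∀ x y, (Percolation.openGraph ω ⊔ wired (insert b T)).Adj x y →
        (H ⊔ edge b b₀).Reachable x y := by
      intro x y hxy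
      rcases hxy with hxy | hxy
      · exact Adj.reachable (Or.inl (Or.inl hxy))
      · rw [wired_adj] at hxy
        obtain ⟨hne, hx, hy⟩ := hxy
        -- a vertex of `insert b T` is joined to `b₀` in `H ⊔ edge b b₀`
        have key : ∀ z ∈ insert b T, (H ⊔ edge b b₀).Reachable z b₀ := by
          intro z hz
          rcases Set.mem_insert_iff.1 hz with rfl | hz
          · exact Adj.reachable (Or.inr ((edge_adj _ _ _ _).2 ⟨Or.inl ⟨rfl, rfl⟩, hb⟩))
          · by_cases hzb : z = b₀
            · subst hzb; exact Reachable.refl _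
            · exact Adj.reachable (Or.inl (Or.inr ((wired_adj _ _ _).2 ⟨hzb, hz, hb₀⟩)))
        exact (key x hx).trans (key y hy).symm
    rw [← card_connectedComponent_eq_of_le_of_adj_reachable hle hadj]
    exact card_connectedComponent_le_sup_edge_add_one H b b₀

omit [Fintype V] in
/-- Wiring the finite set `{b₀} ∪ S` lowers the free cluster count by at most `|S|`.
[cite: Grimmett2006, proof of Thm. (4.58) (k(ω⁰_Λ) − |∂Λ| ≤ k(ω¹_Λ))] -/
theorem clusterCount_empty_le_insert_add_card [Finite V] (ω : Percolation.BondConfig V) (b₀ : V)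
    (S : Finset V) :
    clusterCount ω ∅ ≤ clusterCount ω (↑(insert b₀ S) : Set V) + #S := by
  classical
  induction S using Finset.induction with
  | empty =>
    rw [Finset.insert_empty, Finset.coe_singleton, clusterCount_singleton, Finset.card_empty, add_zero]
  | @insert b S hbS ih =>
    rw [Finset.card_insert_of_notMem hbS, Finset.insert_comm, Finset.coe_insert]
    have h := clusterCount_le_clusterCount_insert_add_one ω
      (T := (↑(insert b₀ S) : Set V)) (b₀ := b₀) (by simp) b
    omega

omit [Fintype V] in
/-- **Wiring a finite set `B` lowers the number of clusters by at most `|B| - 1`**: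
`k^∅(ω) ≤ k^B(ω) + (|B| - 1)`. [cite: Grimmett2006, proof of Thm. (4.58) (k(ω⁰_Λ) − |∂Λ| ≤ k(ω¹_Λ))] -/
theorem clusterCount_empty_le_add_card [Finite V] (ω : Percolation.BondConfig V) (B : Finset V) :
    clusterCount ω ∅ ≤ clusterCount ω (↑B : Set V) + (#B - 1) := by
  classical
  rcases B.eq_empty_or_nonempty with rfl | ⟨b₀, hb₀⟩
  · simp
  · have h := clusterCount_empty_le_insert_add_card ω b₀ (B.erase b₀)
    rw [Finset.insert_erase hb₀, Finset.card_erase_of_mem hb₀] at h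
    exact h

omit [Fintype V] [DecidableEq V] in
/-- Wiring lowers the number of clusters: `k^B(ω) ≤ k^∅(ω)`.
[cite: Grimmett2006, proof of Thm. (4.58) (k(ω¹_Λ) ≤ k(ω⁰_Λ))] -/
theorem clusterCount_le_clusterCount_empty [Finite V] (ω : Percolation.BondConfig V) (B : Set V) :
    clusterCount ω B ≤ clusterCount ω ∅ := by
  rw [clusterCount, clusterCount, wired_empty, sup_bot_eq]
  exact ConnectedComponent.card_le_card_of_le le_sup_left

/-- `w^B(ω) ≤ w^∅(ω)` for `q ≥ 1`. [cite: Grimmett2006, proof of Thm. (4.58) (Y^ξ_Λ ≤ Y⁰_Λ)] -/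
theorem rcWeight_wired_le_free {p q : ℝ} (hp : p ∈ Set.Icc (0 : ℝ) 1) (hq : 1 ≤ q) (B : Set V)
    (ω : Finset (Sym2 V)) : rcWeight G p q B ω ≤ rcWeight G p q ∅ ω := by
  unfold rcWeight
  have h0 : 0 ≤ p ^ #ω * (1 - p) ^ #(G.edgeFinset \ ω) :=
    mul_nonneg (pow_nonneg hp.1 _) (pow_nonneg (sub_nonneg.2 hp.2) _)
  exact mul_le_mul_of_nonneg_left (pow_le_pow_right₀ hq (clusterCount_le_clusterCount_empty _ B)) h0

/-- `w^∅(ω) ≤ q^{|B|-1} w^B(ω)` for `q ≥ 1` and finite `B`.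
[cite: Grimmett2006, proof of Thm. (4.58) (Y⁰_Λ e^{-κ|∂Λ|} ≤ Y^ξ_Λ)] -/
theorem rcWeight_free_le_pow_mul_wired {p q : ℝ} (hp : p ∈ Set.Icc (0 : ℝ) 1) (hq : 1 ≤ q)
    (B : Finset V) (ω : Finset (Sym2 V)) :
    rcWeight G p q ∅ ω ≤ q ^ (#B - 1) * rcWeight G p q (↑B : Set V) ω := by
  unfold rcWeight
  have h0 : 0 ≤ p ^ #ω * (1 - p) ^ #(G.edgeFinset \ ω) :=
    mul_nonneg (pow_nonneg hp.1 _) (pow_nonneg (sub_nonneg.2 hp.2) _)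
  calc p ^ #ω * (1 - p) ^ #(G.edgeFinset \ ω) * q ^ clusterCount (↑ω : Percolation.BondConfig V) ∅
      ≤ p ^ #ω * (1 - p) ^ #(G.edgeFinset \ ω) *
          q ^ (clusterCount (↑ω : Percolation.BondConfig V) (↑B : Set V) + (#B - 1)) :=
        mul_le_mul_of_nonneg_left (pow_le_pow_right₀ hq (clusterCount_empty_le_add_card _ B)) h0
    _ = q ^ (#B - 1) * (p ^ #ω * (1 - p) ^ #(G.edgeFinset \ ω) *
          q ^ clusterCount (↑ω : Percolation.BondConfig V) (↑B : Set V)) := by rw [pow_add]; ring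

/-- **`Z^B ≤ Z^∅`** for `q ≥ 1`. [cite: Grimmett2006, proof of Thm. (4.58) (Y^ξ_Λ ≤ Y⁰_Λ)] -/
theorem rcPartitionFunction_wired_le_free {p q : ℝ} (hp : p ∈ Set.Icc (0 : ℝ) 1) (hq : 1 ≤ q)
    (B : Set V) : rcPartitionFunction G p q B ≤ rcPartitionFunction G p q ∅ :=
  Finset.sum_le_sum fun ω _ => rcWeight_wired_le_free G hp hq B ω

/-- **`Z^∅ ≤ q^{|B|-1} Z^B`** for `q ≥ 1` and finite `B`.
[cite: Grimmett2006, proof of Thm. (4.58) (Y⁰_Λ e^{-κ|∂Λ|} ≤ Y^ξ_Λ)] -/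
theorem rcPartitionFunction_free_le_pow_mul_wired {p q : ℝ} (hp : p ∈ Set.Icc (0 : ℝ) 1)
    (hq : 1 ≤ q) (B : Finset V) :
    rcPartitionFunction G p q ∅ ≤ q ^ (#B - 1) * rcPartitionFunction G p q (↑B : Set V) := by
  rw [rcPartitionFunction, rcPartitionFunction, Finset.mul_sum]
  exact Finset.sum_le_sum fun ω _ => rcWeight_free_le_pow_mul_wired G hp hq B ω

/-- In logarithmic form: `0 ≤ log Z^∅ - log Z^B ≤ (|B| - 1) log q`.
[cite: Grimmett2006, proof of Thm. (4.58) (boundary-condition bounds on G^ξ_Λ)] -/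
theorem log_rcPartitionFunction_free_sub_wired_mem {p q : ℝ} (hp : p ∈ Set.Icc (0 : ℝ) 1)
    (hq : 1 ≤ q) (B : Finset V) :
    Real.log (rcPartitionFunction G p q ∅) - Real.log (rcPartitionFunction G p q (↑B : Set V)) ∈
      Set.Icc 0 (max ((#B : ℝ) - 1) 0 * Real.log q) := by
  have hq0 : 0 < q := one_pos.trans_le hq
  have hZB := rcPartitionFunction_pos G hp hq0 (↑B : Set V)
  have hZ0 := rcPartitionFunction_pos G hp hq0 ∅
  constructor
  · exact sub_nonneg.2 (Real.log_le_log hZB (rcPartitionFunction_wired_le_free G hp hq _))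
  · have h := Real.log_le_log hZ0 (rcPartitionFunction_free_le_pow_mul_wired G hp hq B)
    rw [Real.log_mul (pow_pos hq0 _).ne' hZB.ne', Real.log_pow] at h
    have hcast : ((#B - 1 : ℕ) : ℝ) = max ((#B : ℝ) - 1) 0 := by
      rcases Nat.eq_zero_or_pos #B with h0 | hpos
      · rw [h0]; norm_num
      · rw [Nat.cast_sub hpos, Nat.cast_one, max_eq_left]
        have : (1 : ℝ) ≤ #B := by exact_mod_cast hpos
        linarith
    rw [hcast] at h
    linarith

end Wiring

/-! ### The finite-volume density inequality behind a.e. uniqueness -/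

section Density

/-- **Finite-volume density inequality** (the computation in Grimmett 2006, proof of Thm. (4.63),
(4.73)–(4.75), combined with the boundary bounds of the proof of Thm. (4.58), before any limit is
taken): for `0 < p < p' < 1`, `q ≥ 1` and a finite wired set `B`,
`[log(p'/p) + log((1-p)/(1-p'))] · (∑_e φ^B_{G,p,q}(J_e) - ∑_e φ^∅_{G,p',q}(J_e)) ≤ (|B| - 1)⁺ log q`.
So the wired edge density at the smaller `p` exceeds the free edge density at the larger `p'` by
at most a boundary term. [cite: Grimmett2006, proof of Thm. (4.63), (4.73)–(4.75)] -/
theorem mul_sub_sum_edgeOpen_le {p p' q : ℝ} (hp : 0 < p) (hpp' : p < p') (hp' : p' < 1)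
    (hq : 1 ≤ q) (B : Finset V) :
    (Real.log (p' / p) + Real.log ((1 - p) / (1 - p'))) *
        (∑ e ∈ G.edgeFinset, (rcMeasure G p q (↑B : Set V)).real (edgeOpen e) -
          ∑ e ∈ G.edgeFinset, (rcMeasure G p' q ∅).real (edgeOpen e)) ≤
      max ((#B : ℝ) - 1) 0 * Real.log q := by
  have hq0 : 0 < q := one_pos.trans_le hq
  have hpI : p ∈ Set.Ioo (0 : ℝ) 1 := ⟨hp, hpp'.trans hp'⟩
  have hp'I : p' ∈ Set.Ioo (0 : ℝ) 1 := ⟨hp.trans hpp', hp'⟩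
  have hpc : p ∈ Set.Icc (0 : ℝ) 1 := ⟨hpI.1.le, hpI.2.le⟩
  have hp'c : p' ∈ Set.Icc (0 : ℝ) 1 := ⟨hp'I.1.le, hp'I.2.le⟩
  -- tangent inequalities: wired at `p` towards `p'`, free at `p'` towards `p`
  have hW := log_rcPartitionFunction_sub_ge G hpI hp'I hq0 (↑B : Set V)
  have hF := log_rcPartitionFunction_sub_ge G hp'I hpI hq0 ∅
  rw [rcExpect_card_eq_sum_real_edgeOpen G hpc hq0] at hW
  rw [rcExpect_card_eq_sum_real_edgeOpen G hp'c hq0] at hF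
  -- boundary-condition bounds at `p` and at `p'`
  have hBp := log_rcPartitionFunction_free_sub_wired_mem G hpc hq B
  have hBp' := log_rcPartitionFunction_free_sub_wired_mem G hp'c hq B
  -- the logarithms of the ratios
  have hl1 : Real.log (p / p') = -Real.log (p' / p) := by
    rw [← Real.log_inv, inv_div]
  have hl2 : Real.log ((1 - p') / (1 - p)) = -Real.log ((1 - p) / (1 - p')) := by
    rw [← Real.log_inv, inv_div]
  rw [hl1] at hF
  rw [hl2] at hW
  set a := Real.log (p' / p)
  set c := Real.log ((1 - p) / (1 - p'))
  set MW := ∑ e ∈ G.edgeFinset, (rcMeasure G p q (↑B : Set V)).real (edgeOpen e)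
  set MF := ∑ e ∈ G.edgeFinset, (rcMeasure G p' q ∅).real (edgeOpen e)
  have key : (a + c) * (MW - MF) =
      (a * MW + -c * ((#G.edgeFinset : ℝ) - MW)) + (-a * MF + c * ((#G.edgeFinset : ℝ) - MF)) := by
    ring
  rw [key]
  linarith [hBp.2, hBp'.1, hW, hF]

end Density

/-! ### Prop. (4.6) in finite volume: ordered measures with equal densities agree -/

section Marginals

variable {G}

/-- The counting function of the coupling-free proof of Prop. (4.6): `g(ω) = |ω ∩ F| + 1_{Aᶜ}(ω)`.
It is increasing when `A` is increasing and determined by the edges of `F`. [cite: Grimmett2006, Prop. (4.6)] -/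
def marginalCount (F : Finset (Sym2 V)) (A : Set (Percolation.BondConfig V)) [DecidablePred (· ∈ A)]
    (ω : Percolation.BondConfig V) : ℕ := by
  classical
  exact #(F.filter (· ∈ ω)) + (if ω ∈ A then 0 else 1)

omit [Fintype V] [DecidableEq V] in
/-- `g` is increasing. [cite: Grimmett2006, Prop. (4.6)] -/
theorem marginalCount_mono (F : Finset (Sym2 V)) {A : Set (Percolation.BondConfig V)}
    [DecidablePred (· ∈ A)] (hA : IsUpperSet A)
    (hAF : ∀ ω ω' : Percolation.BondConfig V, (∀ e ∈ F, e ∈ ω ↔ e ∈ ω') → (ω ∈ A ↔ ω' ∈ A))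
    {ω ω' : Percolation.BondConfig V} (h : ω ⊆ ω') : marginalCount F A ω ≤ marginalCount F A ω' := by
  classical
  unfold marginalCount
  have hsub : F.filter (· ∈ ω) ⊆ F.filter (· ∈ ω') := by
    intro e
    simp only [Finset.mem_filter]
    exact fun he => ⟨he.1, h he.2⟩
  by_cases hω : ω ∈ A
  · rw [if_pos hω, if_pos (hA h hω), add_zero, add_zero]
    exact Finset.card_le_card hsub
  · rw [if_neg hω]
    by_cases hω' : ω' ∈ A
    · rw [if_pos hω', add_zero]
      -- the filters differ, since `A` is determined by `F`
      have hne : F.filter (· ∈ ω) ≠ F.filter (· ∈ ω') := by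
        intro heq
        refine hω ((hAF ω ω' fun e he => ?_).2 hω')
        constructor
        · intro h1; exact (Finset.mem_filter.1 (heq ▸ Finset.mem_filter.2 ⟨he, h1⟩)).2
        · intro h1; exact (Finset.mem_filter.1 (heq.symm ▸ Finset.mem_filter.2 ⟨he, h1⟩)).2
      exact Finset.card_lt_card (lt_of_le_of_ne hsub hne)
    · rw [if_neg hω']
      exact Nat.add_le_add_right (Finset.card_le_card hsub) 1

omit [Fintype V] [DecidableEq V] in
/-- `g ≤ |F| + 1`. [cite: Grimmett2006, Prop. (4.6)] -/
theorem marginalCount_le (F : Finset (Sym2 V)) (A : Set (Percolation.BondConfig V))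
    [DecidablePred (· ∈ A)] (ω : Percolation.BondConfig V) : marginalCount F A ω ≤ #F + 1 := by
  classical
  unfold marginalCount
  refine Nat.add_le_add (Finset.card_filter_le _ _) ?_
  split_ifs <;> simp

omit [Fintype V] [DecidableEq V] in
/-- The level sets `{g ≥ j}` are increasing events. [cite: Grimmett2006, Prop. (4.6)] -/
theorem isUpperSet_marginalCount_ge (F : Finset (Sym2 V)) {A : Set (Percolation.BondConfig V)}
    [DecidablePred (· ∈ A)] (hA : IsUpperSet A)
    (hAF : ∀ ω ω' : Percolation.BondConfig V, (∀ e ∈ F, e ∈ ω ↔ e ∈ ω') → (ω ∈ A ↔ ω' ∈ A))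
    (j : ℕ) : IsUpperSet {ω : Percolation.BondConfig V | j ≤ marginalCount F A ω} :=
  fun _ _ h hω => le_trans hω (marginalCount_mono F hA hAF h)

omit [Fintype V] [DecidableEq V] in
/-- Layer-cake: `g(ω) = ∑_{j=1}^{|F|+1} 1[j ≤ g(ω)]`. [folklore] -/
theorem marginalCount_eq_sum_indicator (F : Finset (Sym2 V)) (A : Set (Percolation.BondConfig V))
    [DecidablePred (· ∈ A)] (ω : Percolation.BondConfig V) :
    (marginalCount F A ω : ℝ) =
      ∑ j ∈ Finset.Icc 1 (#F + 1), if j ≤ marginalCount F A ω then (1 : ℝ) else 0 := by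
  rw [Finset.sum_boole]
  have hle := marginalCount_le F A ω
  have : (Finset.Icc 1 (#F + 1)).filter (fun j => j ≤ marginalCount F A ω) =
      Finset.Icc 1 (marginalCount F A ω) := by
    ext j
    simp only [Finset.mem_filter, Finset.mem_Icc]
    omega
  rw [this, Nat.card_Icc, Nat.add_sub_cancel]

/-- The layer-cake identity integrated: `∑_{e ∈ F} φ(J_e) + 1 - φ(A) = ∑_{j=1}^{|F|+1} φ(g ≥ j)`
for every wired set and all parameters. [cite: Grimmett2006, Prop. (4.6)] -/
theorem sum_real_edgeOpen_add_one_sub_real_eq {p q : ℝ} (hp : p ∈ Set.Icc (0 : ℝ) 1) (hq : 0 < q)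
    (B : Set V) (F : Finset (Sym2 V)) (A : Set (Percolation.BondConfig V)) [DecidablePred (· ∈ A)] :
    ∑ e ∈ F, (rcMeasure G p q B).real (edgeOpen e) + 1 - (rcMeasure G p q B).real A =
      ∑ j ∈ Finset.Icc 1 (#F + 1),
        (rcMeasure G p q B).real {ω : Percolation.BondConfig V | j ≤ marginalCount F A ω} := by
  classical
  -- everything as expectations
  have hJ : ∀ e ∈ F, (rcMeasure G p q B).real (edgeOpen e) =
      rcExpect G p q B (fun ω => if e ∈ ω then 1 else 0) := by
    intro e _
    rw [rcMeasure_real_eq_rcExpect G hp hq B]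
    refine rcExpect_congr G p q B fun ω _ => ?_
    simp only [mem_edgeOpen_iff, Finset.mem_coe]
  have hU : ∀ j ∈ Finset.Icc 1 (#F + 1),
      (rcMeasure G p q B).real {ω : Percolation.BondConfig V | j ≤ marginalCount F A ω} =
        rcExpect G p q B (fun ω => if j ≤ marginalCount F A (↑ω) then 1 else 0) := by
    intro j _
    rw [rcMeasure_real_eq_rcExpect G hp hq B]
    rfl
  -- the pointwise layer-cake identity
  have hpt : ∀ ω ⊆ G.edgeFinset,
      (∑ e ∈ F, if e ∈ ω then (1 : ℝ) else 0) + 1 - (if (↑ω : Percolation.BondConfig V) ∈ A then 1 else 0) =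
        ∑ j ∈ Finset.Icc 1 (#F + 1), if j ≤ marginalCount F A (↑ω) then (1 : ℝ) else 0 := by
    intro ω _
    rw [← marginalCount_eq_sum_indicator F A]
    unfold marginalCount
    rw [Finset.card_filter]
    push_cast
    have hs : ∀ e ∈ F, (if e ∈ ω then (1 : ℝ) else 0) =
        (if e ∈ (↑ω : Percolation.BondConfig V) then (1 : ℝ) else 0) := by
      intro e _
      by_cases h : e ∈ ω <;> simp [h]
    rw [Finset.sum_congr rfl hs]
    split_ifs <;> ring
  calc ∑ e ∈ F, (rcMeasure G p q B).real (edgeOpen e) + 1 - (rcMeasure G p q B).real A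
      = rcExpect G p q B (fun ω => ∑ e ∈ F, if e ∈ ω then (1 : ℝ) else 0) +
          rcExpect G p q B (fun _ => 1) -
          rcExpect G p q B (fun ω => if (↑ω : Percolation.BondConfig V) ∈ A then 1 else 0) := by
        rw [Finset.sum_congr rfl hJ, ← rcExpect_finset_sum, rcExpect_one G hp hq B,
          rcMeasure_real_eq_rcExpect G hp hq B A]
    _ = rcExpect G p q B (fun ω => (∑ e ∈ F, if e ∈ ω then (1 : ℝ) else 0) + 1 -
          (if (↑ω : Percolation.BondConfig V) ∈ A then 1 else 0)) := by
        rw [rcExpect_sub, rcExpect_add]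
    _ = rcExpect G p q B (fun ω =>
          ∑ j ∈ Finset.Icc 1 (#F + 1), if j ≤ marginalCount F A (↑ω) then (1 : ℝ) else 0) :=
        rcExpect_congr G p q B hpt
    _ = ∑ j ∈ Finset.Icc 1 (#F + 1),
          (rcMeasure G p q B).real {ω : Percolation.BondConfig V | j ≤ marginalCount F A ω} := by
        rw [rcExpect_finset_sum]
        exact (Finset.sum_congr rfl hU).symm

/-- **Prop. (4.6) of Grimmett 2006, finite-volume quantitative form** (proved without coupling):
if `φ₁ = φ^{B₁}_{G₁,p₁,q₁}` is dominated by `φ₂ = φ^{B₂}_{G₂,p₂,q₂}` on increasing events of a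
common configuration space, then for every increasing event `A` determined by the edges of a
finite set `F`,
`φ₂(A) - φ₁(A) ≤ ∑_{e ∈ F} (φ₂(J_e) - φ₁(J_e))`.
(Because `ω ↦ |ω ∩ F| - 1_A(ω)` is increasing: apply the domination to its level sets.) In
particular, ordered measures with the same edge densities on `F` agree on such `A`.
[cite: Grimmett2006, Prop. (4.6)] -/
theorem real_sub_real_le_sum_edgeOpen_sub {G₁ G₂ : SimpleGraph V} [DecidableRel G₁.Adj]
    [DecidableRel G₂.Adj] {p₁ q₁ p₂ q₂ : ℝ} (hp₁ : p₁ ∈ Set.Icc (0 : ℝ) 1) (hq₁ : 0 < q₁)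
    (hp₂ : p₂ ∈ Set.Icc (0 : ℝ) 1) (hq₂ : 0 < q₂) {B₁ B₂ : Set V}
    (hdom : ∀ U : Set (Percolation.BondConfig V), IsUpperSet U →
      (rcMeasure G₁ p₁ q₁ B₁).real U ≤ (rcMeasure G₂ p₂ q₂ B₂).real U)
    (F : Finset (Sym2 V)) {A : Set (Percolation.BondConfig V)} (hA : IsUpperSet A)
    (hAF : ∀ ω ω' : Percolation.BondConfig V, (∀ e ∈ F, e ∈ ω ↔ e ∈ ω') → (ω ∈ A ↔ ω' ∈ A)) :
    (rcMeasure G₂ p₂ q₂ B₂).real A - (rcMeasure G₁ p₁ q₁ B₁).real A ≤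
      ∑ e ∈ F, ((rcMeasure G₂ p₂ q₂ B₂).real (edgeOpen e) - (rcMeasure G₁ p₁ q₁ B₁).real (edgeOpen e)) := by
  classical
  have h₁ := sum_real_edgeOpen_add_one_sub_real_eq (G := G₁) hp₁ hq₁ B₁ F A
  have h₂ := sum_real_edgeOpen_add_one_sub_real_eq (G := G₂) hp₂ hq₂ B₂ F A
  have hle : ∑ j ∈ Finset.Icc 1 (#F + 1),
        (rcMeasure G₁ p₁ q₁ B₁).real {ω : Percolation.BondConfig V | j ≤ marginalCount F A ω} ≤
      ∑ j ∈ Finset.Icc 1 (#F + 1),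
        (rcMeasure G₂ p₂ q₂ B₂).real {ω : Percolation.BondConfig V | j ≤ marginalCount F A ω} :=
    Finset.sum_le_sum fun j _ => hdom _ (isUpperSet_marginalCount_ge F hA hAF j)
  rw [← h₁, ← h₂] at hle
  rw [Finset.sum_sub_distrib]
  linarith

end Marginals

end Literature.Probability.LatticeModels

end
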